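import Literature.NumberTheory.EllipticCurves.SupersingularSqTorsionValuationProofs
import Literature.NumberTheory.EllipticCurves.Kato2004.TorsionFirstOrderWitnessProofs
import Literature.NumberTheory.EllipticCurves.SerreOpenImageSupersingularInertiaProofs
import Literature.NumberTheory.EllipticCurves.SerreOpenImageTameKummerProofs
import Literature.NumberTheory.EllipticCurves.IwasawaTowerTorsionOrdinaryProofs
import Literature.NumberTheory.EllipticCurves.DivisionField
import Literature.NumberTheory.EllipticCurves.ThreeTorsionInertiaStructureProofs
import Literature.NumberTheory.EllipticCurves.OggWildThreeEisensteinDataProofs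
import Literature.NumberTheory.EllipticCurves.Wuthrich2014.ThreeAdicImageOrdinaryProofs
import Literature.NumberTheory.GaloisRepresentations.InertiaLiftAbsoluteProofs
import Literature.NumberTheory.EllipticCurves.GlobalMinimalModelProofs
import Literature.NumberTheory.EllipticCurves.NoEverywhereGoodReductionRat
import Literature.NumberTheory.EllipticCurves.BSDSelmerSkinnerThmBProofs
import Literature.NumberTheory.EllipticCurves.ExceptionalPrimesDensityModels
import HarnessLib

/-!
# Wuthrich 2014, Lemma 20 — the good SUPERSINGULAR case PROVED: at a good supersingular prime
# `3`, `ρ̄_{E,3}` onto `GL₂(𝔽₃)` ⟹ `ρ̄_{E,3ⁿ}` onto for every `n` (so Lemma 20 holds as printed)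

`Proofs` file (theorems only: no definition, no named fact, debt 0), topic
`NumberTheory/EllipticCurves`, sibling of `Wuthrich2014/ThreeAdicImage.lean` (the named fact
`Wuthrich2014.lemma20_surjective_threeAdic_of_semistable`, C. Wuthrich, Doc. Math. 19 (2014),
Lemma 20, p. 399: "Let `p = 3` and suppose `p²` does not divide the conductor `N`. If the residual
representation `ρ̄ : Gal(ℚ̄/ℚ) → GL₂(𝔽_p)` is surjective then the `p`-adic representation
`ρ : Gal(ℚ̄/ℚ) → GL₂(ℤ_p)` is surjective, too.") and of
`Wuthrich2014/ThreeAdicImageOrdinaryProofs.lean` (unit `b2b-bsdres-lit-kato` gen 7: the good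
ORDINARY and the MULTIPLICATIVE cases, by inertia words `(1 + 3·(2 *; 0 0))`).  The printed proof
(pp. 399–400) is global — Elkies' parametrisation of the exotic `3`-adic images; this file gives a
LOCAL proof of the one remaining case, good supersingular reduction at `3`, whence the named fact
as printed (`Wuthrich2014.lemma20_surjective_threeAdic_of_semistable_holds`) on globally minimal
models, and Lemma 20 at every curve not additive at `3`.

## The argument (all inputs tree THEOREMS)

Let `E = W/ℚ` be minimal with good supersingular reduction at `3` (`3 ∤ Δ`, `3 ∣ a₃`) and
`ρ̄_{E,3}` onto.  Let `𝔓` be the prime of `\bar ℤ` of the place `placeOver 3`, `I = I_𝔓 ≤ Γ_ℚ`,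
`I₁ = I ∩ ker ρ̄_{E,3}`.
1. (`SupersingularSqTorsionValuationProofs`) every `Q ∈ E[9] ∖ E[3]` has abscissa of valuation
   `v(x_Q)^{36} v(3) = 1`; read in the `9`-division field `L = ℚ(E[9])` at `P_L = 𝔓 ∩ L` this says
   `36 · ord_{P_L}(x_Q) = -ord_{P_L}(3) = -e(P_L ∣ 3)`, so `36 ∣ e` (the valuation ring of the
   place meets `L` in the local ring at `P_L`, Mathlib `exists_primeCompl_mul_eq_or_mul_eq`).
2. Hilbert theory: `e = #I(P_L)` (`ord_algebraMap_eq_card_inertia_of_mem_primesAbove`) and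
   `I(P_L) = I_𝔓|_L` (`inertia_comap_eq_map_absRestrictNormalHom`, Serre *Local Fields* I §7
   Prop. 22 (b)); the kernel of `Γ_ℚ → Gal(L/ℚ)` is the fixer of `E[9]`
   (`absRestrictNormalHom_divisionField_eq_one_iff`), so `#ρ̄_{E,9}(I) = #I(P_L)` is divisible by
   `36`; and `#ρ̄_{E,3}(I) = 8` (Serre 1972 §1.11 Prop. 12 c),
   `isCyclic_and_card_inertia_map_of_dvd_frobeniusTrace`), so `#ρ̄_{E,9}(I₁)` is divisible by `9`.
3. The elements of `Aut(E[9])` of the form `Q ↦ (1 + 3m)Q` are only `3`; hence some `s₁ ∈ I₁` is not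
   of this form.  Some `s₂ ∈ I₁` has `χ₃(s₂) ≡ 7 (mod 9)` (`χ₃(I) = ℤ₃ˣ`,
   `exists_mem_inertia_cyclotomicCharacter_eq`, eighth power), hence moves `ζ₉`.  One of
   `s₁, s₂, s₁s₂` does both.
4. `Kato2004/TorsionFirstOrderWitnessProofs`: such an element plus surj(3) gives the tower
   (Serre IV-23 with a first-order witness, `Kato2004/Condition1252`).

Cell `bsd-rank1-residual` (team n1011, sub-target T-b2): this retires the good-supersingular scope
of the named fact A9 and makes the `3`-adic tower a THEOREM on the additive potentially-good rows of
class X4 at `3` whose semistable quadratic twist is good supersingular.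

## References

* [Wuthrich2014] C. Wuthrich, Doc. Math. 19 (2014) 381–402, Lemma 20 (p. 399), Cor. 19.
* [Serre1972] J.-P. Serre, Invent. Math. 15 (1972), §1.11 Prop. 12, §1.3 Prop. 1–2.
* [SerreAbelianLadic1968] J.-P. Serre, *Abelian ℓ-adic representations* (1968), IV-23 Lemma 3.
* [SerreLocalFields1979] J.-P. Serre, *Local Fields*, Ch. I §7 Prop. 20–22 and Cor. to Prop. 21.
* [Elkies2006] N. D. Elkies, arXiv:math/0612734 (the exotic images this excludes at good `3`).
-/

noncomputable section

open scoped Classical NumberField Pointwise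
open Field IsDedekindDomain WeierstrassCurve

-- As in `ThreeTorsionInertiaStructureProofs` / `InertiaFieldLayer`: pin `Algebra ℚ ℚ̄` to
-- `AlgebraicClosure.instAlgebra` (the instance under which `absoluteGaloisGroup ℚ`, `divisionField`,
-- `absIntegers` are stated) rather than `DivisionRing.toRatAlgebra`; no library instance is overridden
-- in substance (`Subsingleton (Algebra ℚ _)`).
attribute [local instance 1001] IntermediateField.algebra'
attribute [local instance 1002] AlgebraicClosure.instAlgebra

namespace Literature.NumberTheory.EllipticCurves

open Literature.NumberTheory.GaloisRepresentations Rat.HeightOneSpectrum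

/-! ### §1 The place over `p` restricted to a finite subextension `L ⊆ ℚ̄` is the `P_L`-adic valuation -/

section PlaceBridge

variable (p : ℕ) [Fact p.Prime] (L : IntermediateField ℚ (AlgebraicClosure ℚ))
  [FiniteDimensional ℚ L]

omit [FiniteDimensional ℚ L] in
/-- Elements of `𝓞_L` are algebraic integers, hence lie in every place of `ℚ̄`. [folklore] -/
private theorem coe_integralClosure_mem_placeOver (s : integralClosure (𝓞 ℚ) L) :
    (((s : L) : AlgebraicClosure ℚ)) ∈ placeOver p :=
  coe_absIntegers_mem_placeOver p (L.integralClosureToAbsIntegers (𝓞 ℚ) s)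

variable {p L}

omit [FiniteDimensional ℚ L] in
/-- For `s ∈ 𝓞_L` and `P_L = 𝔓 ∩ 𝓞_L` with `𝔓` the prime of the place: `s ∈ P_L ↔ v(s) < 1`.
[folklore] -/
private theorem mem_comap_iff_valuation_placeOver_lt_one {𝔓 : Ideal (absIntegers (𝓞 ℚ) ℚ)}
    (hmem : ∀ x : absIntegers (𝓞 ℚ) ℚ, x ∈ 𝔓 ↔ (x : AlgebraicClosure ℚ) ∈ (placeOver p).nonunits)
    (s : integralClosure (𝓞 ℚ) L) :
    s ∈ 𝔓.comap (L.integralClosureToAbsIntegers (𝓞 ℚ)) ↔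
      (placeOver p).valuation (((s : L) : AlgebraicClosure ℚ)) < 1 := by
  rw [Ideal.mem_comap, hmem, ValuationSubring.mem_nonunits_iff]
  rfl

/-- **The place restricted to `L` is the `P_L`-adic valuation**: for `z ∈ L`,
`z ∈ 𝒪_𝔓 ↔ w_{P_L}(z) ≤ 1`, where `P_L = 𝔓 ∩ 𝓞_L` and `w_{P_L}` is the `P_L`-adic valuation of
the Dedekind domain `𝓞_L` on its fraction field `L` (every `z` is `n/d` or `d/n` with `d ∉ P_L`,
Mathlib `exists_primeCompl_mul_eq_or_mul_eq`). Ref: Serre, *Local Fields*, Ch. I §7 (Prop. 19–21: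
the place `𝔓` of `\bar ℤ` over `P_L`). [cite: SerreLocalFields1979, Ch. I §7 Prop. 19–21] -/
theorem coe_mem_placeOver_iff_valuation_le_one {𝔓 : Ideal (absIntegers (𝓞 ℚ) ℚ)}
    (hmem : ∀ x : absIntegers (𝓞 ℚ) ℚ, x ∈ 𝔓 ↔ (x : AlgebraicClosure ℚ) ∈ (placeOver p).nonunits)
    (w : HeightOneSpectrum (integralClosure (𝓞 ℚ) L))
    (hw : w.asIdeal = 𝔓.comap (L.integralClosureToAbsIntegers (𝓞 ℚ))) (z : L) :
    haveI : IsDedekindDomain (integralClosure (𝓞 ℚ) L) := integralClosure.isDedekindDomain (𝓞 ℚ) ℚ L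
    haveI : IsFractionRing (integralClosure (𝓞 ℚ) L) L :=
      integralClosure.isFractionRing_of_finite_extension ℚ L
    (z : AlgebraicClosure ℚ) ∈ placeOver p ↔ w.valuation L z ≤ 1 := by
  haveI : IsDedekindDomain (integralClosure (𝓞 ℚ) L) := integralClosure.isDedekindDomain (𝓞 ℚ) ℚ L
  haveI : IsFractionRing (integralClosure (𝓞 ℚ) L) L :=
    integralClosure.isFractionRing_of_finite_extension ℚ L
  set v := (placeOver p).valuation with hv
  -- dictionary on integral elements
  have hint : ∀ s : integralClosure (𝓞 ℚ) L, v (((s : L) : AlgebraicClosure ℚ)) ≤ 1 := fun s ↦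
    ((placeOver p).valuation_le_one_iff _).mpr (coe_integralClosure_mem_placeOver p L s)
  have hlt : ∀ s : integralClosure (𝓞 ℚ) L,
      s ∈ w.asIdeal ↔ v (((s : L) : AlgebraicClosure ℚ)) < 1 := fun s ↦ by
    rw [hw]; exact mem_comap_iff_valuation_placeOver_lt_one hmem s
  have halg : ∀ s : integralClosure (𝓞 ℚ) L, algebraMap (integralClosure (𝓞 ℚ) L) L s = (s : L) :=
    fun _ ↦ rfl
  constructor
  · intro hz
    have hvz : v (z : AlgebraicClosure ℚ) ≤ 1 := ((placeOver p).valuation_le_one_iff _).mpr hz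
    obtain ⟨n, d, h⟩ := w.exists_primeCompl_mul_eq_or_mul_eq (K := L) z
    have hd1 : w.valuation L (algebraMap _ L (d : integralClosure (𝓞 ℚ) L)) = 1 := by
      rw [HeightOneSpectrum.valuation_of_algebraMap, HeightOneSpectrum.intValuation_eq_one_iff]
      exact d.2
    rcases h with h | h
    · -- `z d = n`
      have h1 : w.valuation L z * w.valuation L (algebraMap _ L (d : integralClosure (𝓞 ℚ) L)) ≤ 1 := by
        rw [← map_mul, h, HeightOneSpectrum.valuation_of_algebraMap]
        exact w.intValuation_le_one n
      rwa [hd1, mul_one] at h1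
    · -- `z n = d`: then `v(n) = 1`, so `n ∉ P_L` and `w z = 1`
      have hvd : v (((d : integralClosure (𝓞 ℚ) L) : L) : AlgebraicClosure ℚ) = 1 := by
        refine le_antisymm (hint _) ?_
        by_contra hlt'
        rw [not_le] at hlt'
        exact d.2 ((hlt _).mpr hlt')
      have hvn : v (((n : L)) : AlgebraicClosure ℚ) = 1 := by
        refine le_antisymm (hint _) ?_
        have hprod : v (z : AlgebraicClosure ℚ) * v (((n : L)) : AlgebraicClosure ℚ) = 1 := by
          rw [← map_mul]
          have := congrArg (fun t : L ↦ v (t : AlgebraicClosure ℚ)) h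
          simp only [halg] at this
          rw [← hvd]
          exact_mod_cast this
        calc (1 : (placeOver p).ValueGroup) = v (z : AlgebraicClosure ℚ) * v ((n : L) : AlgebraicClosure ℚ) :=
              hprod.symm
          _ ≤ 1 * v ((n : L) : AlgebraicClosure ℚ) := by gcongr
          _ = _ := one_mul _
      have hn : (n : integralClosure (𝓞 ℚ) L) ∉ w.asIdeal := fun hn ↦ by
        have := (hlt n).mp hn
        rw [hvn] at this
        exact lt_irrefl _ this
      have hwn : w.valuation L (algebraMap _ L n) = 1 := by
        rw [HeightOneSpectrum.valuation_of_algebraMap, HeightOneSpectrum.intValuation_eq_one_iff]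
        exact hn
      have h1 : w.valuation L z * w.valuation L (algebraMap _ L n) = 1 := by
        rw [← map_mul, h, hd1]
      rw [hwn, mul_one] at h1
      exact h1.le
  · intro hz
    obtain ⟨n, d, h⟩ := w.exists_primeCompl_mul_eq_of_integer (K := L) z hz
    have hvd : v (((d : integralClosure (𝓞 ℚ) L) : L) : AlgebraicClosure ℚ) = 1 := by
      refine le_antisymm (hint _) ?_
      by_contra hlt'
      rw [not_le] at hlt'
      exact d.2 ((hlt _).mpr hlt')
    have hprod : v (z : AlgebraicClosure ℚ) * v (((d : integralClosure (𝓞 ℚ) L) : L) : AlgebraicClosure ℚ) ≤ 1 := by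
      rw [← map_mul]
      have := congrArg (fun t : L ↦ v (t : AlgebraicClosure ℚ)) h
      simp only [halg] at this
      have h' : v ((z : AlgebraicClosure ℚ) * (((d : integralClosure (𝓞 ℚ) L) : L) : AlgebraicClosure ℚ)) =
          v (((n : L)) : AlgebraicClosure ℚ) := by exact_mod_cast this
      rw [h']
      exact hint n
    rw [hvd, mul_one] at hprod
    exact ((placeOver p).valuation_le_one_iff _).mp hprod

/-- Consequence: **`v(z) = 1 ↔ w_{P_L}(z) = 1`** for `z ∈ L`.
[cite: SerreLocalFields1979, Ch. I §7 Prop. 19–21] -/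
theorem valuation_placeOver_eq_one_iff_valuation_eq_one {𝔓 : Ideal (absIntegers (𝓞 ℚ) ℚ)}
    (hmem : ∀ x : absIntegers (𝓞 ℚ) ℚ, x ∈ 𝔓 ↔ (x : AlgebraicClosure ℚ) ∈ (placeOver p).nonunits)
    (w : HeightOneSpectrum (integralClosure (𝓞 ℚ) L))
    (hw : w.asIdeal = 𝔓.comap (L.integralClosureToAbsIntegers (𝓞 ℚ))) {z : L} (hz : z ≠ 0) :
    haveI : IsDedekindDomain (integralClosure (𝓞 ℚ) L) := integralClosure.isDedekindDomain (𝓞 ℚ) ℚ L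
    haveI : IsFractionRing (integralClosure (𝓞 ℚ) L) L :=
      integralClosure.isFractionRing_of_finite_extension ℚ L
    (placeOver p).valuation (z : AlgebraicClosure ℚ) = 1 ↔ w.valuation L z = 1 := by
  haveI : IsDedekindDomain (integralClosure (𝓞 ℚ) L) := integralClosure.isDedekindDomain (𝓞 ℚ) ℚ L
  haveI : IsFractionRing (integralClosure (𝓞 ℚ) L) L :=
    integralClosure.isFractionRing_of_finite_extension ℚ L
  have hz' : (z : AlgebraicClosure ℚ) ≠ 0 := by exact_mod_cast hz
  have h1 := coe_mem_placeOver_iff_valuation_le_one hmem w hw z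
  have h2 := coe_mem_placeOver_iff_valuation_le_one hmem w hw z⁻¹
  rw [← ValuationSubring.valuation_le_one_iff] at h1 h2
  push_cast at h2
  rw [map_inv₀, map_inv₀, inv_le_one₀ (zero_lt_iff.mpr ((Valuation.ne_zero_iff _).mpr hz')),
    inv_le_one₀ (zero_lt_iff.mpr ((Valuation.ne_zero_iff _).mpr hz))] at h2
  constructor
  · intro h; exact le_antisymm (h1.mp h.le) (h2.mp h.ge)
  · intro h; exact le_antisymm (h1.mpr h.le) (h2.mpr h.ge)

end PlaceBridge

/-! ### §2 At a good supersingular `3`: `36` divides the order of the image of inertia on `E[9]` -/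

section Ramification

variable {W : WeierstrassCurve ℚ} [W.IsGloballyMinimal] [W.IsElliptic]

/-- `3 ∈ v` and `3 ∉ v²` for the place `v` of `ℚ` at `3` (`v = (3)` in `𝓞 ℚ ≅ ℤ`). [folklore] -/
private theorem three_mem_and_not_mem_sq {v : HeightOneSpectrum (𝓞 ℚ)} (hv : (primesEquiv v : ℕ) = 3) :
    ((3 : ℕ) : 𝓞 ℚ) ∈ v.asIdeal ∧ ((3 : ℕ) : 𝓞 ℚ) ∉ v.asIdeal ^ 2 := by
  have hgen : natGenerator v = 3 := hv
  set e := Rat.IsIntegralClosure.intEquiv (𝓞 ℚ) with he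
  refine ⟨?_, ?_⟩
  · have h := (natGenerator_dvd_iff v).mp (dvd_refl (natGenerator v))
    rw [hgen] at h
    rwa [← map_natCast e, Ideal.apply_mem_of_equiv_iff] at h
  · intro h3
    have h' : e ((3 : ℕ) : 𝓞 ℚ) ∈ (v.asIdeal ^ 2).map e := Ideal.mem_map_of_mem _ h3
    rw [Ideal.map_pow, ← span_natGenerator, hgen, Ideal.span_singleton_pow, map_natCast,
      Ideal.mem_span_singleton] at h'
    norm_num at h'

/-- **At a good supersingular `3`, `36 ∣ #ρ̄_{E,9}(I_𝔓)`** for the prime `𝔓` of the place over `3`: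
read `v(x_Q)^{36} v(3) = 1` (`valuation_X_pow_mul_eq_one_of_sq_torsion`, `Q ∈ E[9] ∖ E[3]`) in the
`9`-division field `L = ℚ(E[9])` at `P_L = 𝔓 ∩ 𝓞_L`: `36 · ord_{P_L}(x_Q) = e(P_L ∣ 3)`; and
`e = #I(P_L)` (Hilbert theory) with `I(P_L) = I_𝔓|_L ≅ ρ̄_{E,9}(I_𝔓)` (the kernel of
`Γ_ℚ → Gal(L/ℚ)` is the fixer of `E[9]`). [cite: SerreLocalFields1979, Ch. I §7 Cor. to Prop. 21 and Prop. 22(b)]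
[cite: Serre1972, §1.11 Prop. 12] -/
theorem dvd_card_inertia_map_galoisRepTorsion_nine
    (hΔ : ¬ (3 : ℤ) ∣ minimalDiscriminantInt W) (hss : (3 : ℤ) ∣ W.frobeniusTrace 3)
    {v : HeightOneSpectrum (𝓞 ℚ)} (hv : (primesEquiv v : ℕ) = 3)
    {𝔓 : Ideal (absIntegers (𝓞 ℚ) ℚ)}
    (hmem : ∀ x : absIntegers (𝓞 ℚ) ℚ, x ∈ 𝔓 ↔ (x : AlgebraicClosure ℚ) ∈ (placeOver 3).nonunits)
    (h𝔓 : 𝔓 ∈ v.primesAbove) :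
    36 ∣ Nat.card ((𝔓.inertia (absoluteGaloisGroup ℚ)).map (galoisRepTorsion W 9)) := by
  haveI : Fact (Nat.Prime 3) := ⟨Nat.prime_three⟩
  haveI : NeZero (9 : ℕ) := ⟨by norm_num⟩
  haveI : 𝔓.IsPrime := h𝔓.1
  haveI h𝔓max : 𝔓.IsMaximal := HeightOneSpectrum.isMaximal_of_mem_primesAbove h𝔓
  set L := W.divisionField 9 with hL
  haveI : IsGalois ℚ L := inferInstance
  haveI hDD : IsDedekindDomain (integralClosure (𝓞 ℚ) L) := integralClosure.isDedekindDomain (𝓞 ℚ) ℚ L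
  haveI : IsFractionRing (integralClosure (𝓞 ℚ) L) L :=
    integralClosure.isFractionRing_of_finite_extension ℚ L
  set PL := 𝔓.comap (L.integralClosureToAbsIntegers (𝓞 ℚ)) with hPL
  haveI hPLmax : PL.IsMaximal := isMaximal_comap_integralClosureToAbsIntegers (𝓞 ℚ) 𝔓 L
  obtain ⟨h3v, h3v2⟩ := three_mem_and_not_mem_sq hv
  -- `3 ∈ P_L`, so `P_L ≠ 0`
  have h3PL : algebraMap (𝓞 ℚ) (integralClosure (𝓞 ℚ) L) ((3 : ℕ) : 𝓞 ℚ) ∈ PL := by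
    have hunder : PL.under (𝓞 ℚ) = v.asIdeal := by
      rw [hPL, under_comap_integralClosureToAbsIntegers, ← h𝔓.2.over]
    have : ((3 : ℕ) : 𝓞 ℚ) ∈ PL.under (𝓞 ℚ) := by rw [hunder]; exact h3v
    rwa [Ideal.under_def, Ideal.mem_comap] at this
  have hPL0 : PL ≠ ⊥ := by
    intro h0
    rw [h0, Ideal.mem_bot] at h3PL
    have hinj : Function.Injective (algebraMap (𝓞 ℚ) (integralClosure (𝓞 ℚ) L)) :=
      (faithfulSMul_iff_algebraMap_injective _ _).mp (faithfulSMul_integralClosure (𝓞 ℚ) (K := ℚ) (L := L))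
    have h30 : ((3 : ℕ) : 𝓞 ℚ) = 0 := hinj (h3PL.trans (map_zero _).symm)
    apply h3v2
    rw [h30]
    exact Submodule.zero_mem _
  set w : HeightOneSpectrum (integralClosure (𝓞 ℚ) L) := ⟨PL, hPLmax.isPrime, hPL0⟩ with hw
  -- Hilbert theory: `ord_{P_L}(3) = #I(P_L) = #I_𝔓|_L`
  have hord := ord_algebraMap_eq_card_inertia_of_mem_primesAbove h𝔓 L h3v h3v2
  rw [map_natCast, Ideal.ramificationSubgroup_zero,
    inertia_comap_eq_map_absRestrictNormalHom (R := 𝓞 ℚ) 𝔓 L] at hord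
  -- the restriction to `L` and `ρ̄_{E,9}` have the same kernel, hence images of the same size
  set I := 𝔓.inertia (absoluteGaloisGroup ℚ) with hI
  have hker : (absRestrictNormalHom L).ker = (galoisRepTorsion W 9).ker := by
    ext σ
    simp only [MonoidHom.mem_ker]
    exact (W.absRestrictNormalHom_divisionField_eq_one_iff 9 σ).trans
      (galoisRepTorsion_eq_one_iff' W 9 σ).symm
  have hcardA : Nat.card (I.map (absRestrictNormalHom L)) = Nat.card (I.map (galoisRepTorsion W 9)) := by
    rw [← Subgroup.relIndex_ker, ← Subgroup.relIndex_ker, hker]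
  set e : ℕ := Nat.card (I.map (galoisRepTorsion W 9)) with he
  rw [hcardA] at hord
  -- `w(3) = exp(-e)`
  have hw3 : w.valuation L (3 : L) = WithZero.exp (-(e : ℤ)) := by
    have h3alg : (3 : L) = algebraMap (integralClosure (𝓞 ℚ) L) L 3 := by rw [map_ofNat]
    rw [h3alg, HeightOneSpectrum.valuation_of_algebraMap,
      ← WeierstrassCurve.OggWild.ord_eq_natCast_iff_intValuation_eq w (3 : integralClosure (𝓞 ℚ) L) e]
    have h3map : algebraMap (𝓞 ℚ) (integralClosure (𝓞 ℚ) L) ((3 : ℕ) : 𝓞 ℚ) = 3 := by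
      rw [map_natCast]; rfl
    rw [← h3map]
    exact hord
  -- a point `Q ∈ E[9] ∖ E[3]` and its abscissa `x ∈ L`
  obtain ⟨Q, hQ9, hQ3⟩ : ∃ Q : W.geomPoints, ((9 : ℕ) : ℤ) • Q = 0 ∧ ((3 : ℕ) : ℤ) • Q ≠ 0 := by
    by_contra hnone
    push Not at hnone
    have h9 : ((9 : ℕ) : AlgebraicClosure ℚ) ≠ 0 := by norm_num
    have h3 : ((3 : ℕ) : AlgebraicClosure ℚ) ≠ 0 := by norm_num
    have hc9 : Nat.card (geomTorsion W ((9 : ℕ) : ℤ)) = 9 ^ 2 :=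
      card_torsionPoints_eq_sq_holds W (AlgebraicClosure ℚ) (n := 9) h9
    have hc3 : Nat.card (geomTorsion W ((3 : ℕ) : ℤ)) = 3 ^ 2 :=
      card_torsionPoints_eq_sq_holds W (AlgebraicClosure ℚ) (n := 3) h3
    haveI : Finite (geomTorsion W ((3 : ℕ) : ℤ)) := Nat.finite_of_card_ne_zero (by rw [hc3]; norm_num)
    have hle : geomTorsion W ((9 : ℕ) : ℤ) ≤ geomTorsion W ((3 : ℕ) : ℤ) := fun Q hQ ↦
      (Submodule.mem_torsionBy_iff _ _).mpr (hnone Q ((Submodule.mem_torsionBy_iff _ _).mp hQ))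
    have := Nat.card_le_card_of_injective _ (AddSubgroup.inclusion_injective hle)
    rw [hc9, hc3] at this
    omega
  have hQ' : ((3 : ℕ) : ℤ) • (((3 : ℕ) : ℤ) • Q) = 0 := by
    rw [smul_smul]; exact_mod_cast hQ9
  obtain ⟨x, y, h, hQxy⟩ := geomPoints.exists_eq_some (P := Q)
    (fun h0 ↦ hQ3 (by rw [h0, smul_zero]))
  obtain ⟨hx1, hx36⟩ := valuation_X_pow_mul_eq_one_of_sq_torsion 3 hΔ hss (by norm_num) hQ' hQ3 hQxy
  norm_num at hx36
  -- `x ∈ L`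
  have hQmem : Q ∈ geomTorsion W ((9 : ℕ) : ℤ) := (Submodule.mem_torsionBy_iff _ _).mpr hQ9
  obtain ⟨hxL, -⟩ := W.mem_divisionField_of_eq_some (n := 9) (T := ⟨Q, hQmem⟩) hQxy
  set xL : L := ⟨x, hxL⟩ with hxLdef
  have hxL0 : xL ≠ 0 := by
    intro h0
    have : x = 0 := by simpa [hxLdef] using congrArg (fun t : L ↦ (t : AlgebraicClosure ℚ)) h0
    rw [this, map_zero] at hx1
    exact not_lt_zero hx1
  -- transfer `v(x^36 · 3) = 1` to `w`
  have hz : (xL ^ 36 * 3 : L) ≠ 0 := mul_ne_zero (pow_ne_zero _ hxL0) three_ne_zero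
  have hvz : (placeOver 3).valuation ((xL ^ 36 * 3 : L) : AlgebraicClosure ℚ) = 1 := by
    push_cast
    rw [map_mul, map_pow]
    exact_mod_cast hx36
  have hwz := (valuation_placeOver_eq_one_iff_valuation_eq_one hmem w rfl hz).mp hvz
  rw [map_mul, map_pow, hw3] at hwz
  -- `w(xL) = exp k`, so `36 k = e`
  have hwx0 : w.valuation L xL ≠ 0 := (Valuation.ne_zero_iff _).mpr hxL0
  obtain ⟨k, hk⟩ : ∃ k : ℤ, w.valuation L xL = WithZero.exp k :=
    ⟨WithZero.log (w.valuation L xL), (WithZero.exp_log hwx0).symm⟩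
  rw [hk, ← WithZero.exp_nsmul, ← WithZero.exp_add, ← WithZero.exp_zero, WithZero.exp_inj] at hwz
  simp only [nsmul_eq_mul] at hwz
  push_cast at hwz
  have hk0 : 0 ≤ k := by omega
  refine ⟨k.toNat, ?_⟩
  zify
  rw [Int.toNat_of_nonneg hk0]
  omega

end Ramification

/-! ### §3 Elements of the inertia group fixing `E[3]`: one is not a scalar `(1+3m)·` on `E[9]`,
one moves `ζ₉` -/

section Witness

variable {W : WeierstrassCurve ℚ} [W.IsGloballyMinimal] [W.IsElliptic]

omit [W.IsGloballyMinimal] in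
/-- `#ρ̄_{E,9}(I_𝔓) ≠ 0` (it is the order of a subgroup of the finite group `Gal(ℚ(E[9])/ℚ)`). [folklore] -/
private theorem card_inertia_map_galoisRepTorsion_nine_pos {𝔓 : Ideal (absIntegers (𝓞 ℚ) ℚ)}
    [𝔓.IsPrime] :
    0 < Nat.card ((𝔓.inertia (absoluteGaloisGroup ℚ)).map (galoisRepTorsion W 9)) := by
  haveI : NeZero (9 : ℕ) := ⟨by norm_num⟩
  set L := W.divisionField 9 with hL
  set I := 𝔓.inertia (absoluteGaloisGroup ℚ) with hI
  have hker : (absRestrictNormalHom L).ker = (galoisRepTorsion W 9).ker := by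
    ext σ
    simp only [MonoidHom.mem_ker]
    exact (W.absRestrictNormalHom_divisionField_eq_one_iff 9 σ).trans
      (galoisRepTorsion_eq_one_iff' W 9 σ).symm
  have hcardA : Nat.card (I.map (absRestrictNormalHom L)) = Nat.card (I.map (galoisRepTorsion W 9)) := by
    rw [← Subgroup.relIndex_ker, ← Subgroup.relIndex_ker, hker]
  rw [← hcardA]
  haveI : Finite (I.map (absRestrictNormalHom L)) := inferInstance
  exact Nat.card_pos

omit [W.IsGloballyMinimal] [W.IsElliptic] in
/-- If `ρ̄(s t)` and `ρ̄(t)` act on `E[9]` as scalars `≡ 1 (mod 3)`, so does `ρ̄(s)`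
(`(1+3m')³ ≡ 1 (mod 9)`). [folklore] -/
private theorem scalar_of_scalar_mul_of_scalar {s t : absoluteGaloisGroup ℚ}
    (hst : ∃ m : ℕ, ∀ Q ∈ geomTorsion W 9, (s * t) • Q = (1 + 3 * m) • Q)
    (ht : ∃ m : ℕ, ∀ Q ∈ geomTorsion W 9, t • Q = (1 + 3 * m) • Q) :
    ∃ m : ℕ, ∀ Q ∈ geomTorsion W 9, s • Q = (1 + 3 * m) • Q := by
  obtain ⟨m, hm⟩ := hst
  obtain ⟨m', hm'⟩ := ht
  refine ⟨m + 2 * m' + 6 * m * m' + 3 * m' ^ 2 + 9 * m * m' ^ 2, fun Q hQ ↦ ?_⟩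
  have hQ' : Q ∈ AddSubgroup.torsionBy W.geomPoints ((9 : ℕ) : ℤ) := by exact_mod_cast hQ
  have h9Q : (9 : ℕ) • Q = 0 := AddSubgroup.torsionBy.nsmul_iff.mp hQ'
  have hsQ : (9 : ℕ) • (s • Q) = 0 := by rw [smul_comm, h9Q, smul_zero]
  -- `(1 + 3m') • (s • Q) = (1 + 3m) • Q`
  have h1 : (1 + 3 * m') • (s • Q) = (1 + 3 * m) • Q := by
    rw [← smul_comm s, ← hm' Q hQ, ← mul_smul]
    exact hm Q hQ
  -- multiply by `(1 + 3m')²`; `(1 + 3m')³ ≡ 1 (mod 9)`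
  have h2 : ((1 + 3 * m') ^ 2 * (1 + 3 * m')) • (s • Q) = ((1 + 3 * m') ^ 2 * (1 + 3 * m)) • Q := by
    rw [mul_smul, mul_smul, h1]
  have hcube : ((1 + 3 * m') ^ 2 * (1 + 3 * m')) • (s • Q) = s • Q := by
    have : (1 + 3 * m') ^ 2 * (1 + 3 * m') = 1 + 9 * (m' + 3 * m' ^ 2 + 3 * m' ^ 3) := by ring
    rw [this, add_smul, one_smul, mul_smul, smul_comm (9 : ℕ), hsQ, smul_zero, add_zero]
  rw [hcube] at h2
  rw [h2]
  congr 1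
  ring

/-- **Some element of `I_𝔓` fixing `E[3]` is not a scalar `(1 + 3m)·` on `E[9]`** (good supersingular
`3`): such scalars number at most `3`, while `ρ̄_{E,9}(I_𝔓 ∩ ker ρ̄_{E,3})` has order
`#ρ̄_{E,9}(I_𝔓)/#ρ̄_{E,3}(I_𝔓) = #ρ̄_{E,9}(I_𝔓)/8`, divisible by `9`
(`dvd_card_inertia_map_galoisRepTorsion_nine`, `isCyclic_and_card_inertia_map_of_dvd_frobeniusTrace`).
[cite: Serre1972, §1.11 Prop. 12 c)] [cite: SerreLocalFields1979, Ch. I §7 Cor. to Prop. 21] -/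
theorem exists_mem_inertia_fixing_three_not_scalar_nine
    (hΔ : ¬ (3 : ℤ) ∣ minimalDiscriminantInt W) (hss : (3 : ℤ) ∣ W.frobeniusTrace 3)
    {v : HeightOneSpectrum (𝓞 ℚ)} (hv : (primesEquiv v : ℕ) = 3)
    {𝔓 : Ideal (absIntegers (𝓞 ℚ) ℚ)}
    (hmem : ∀ x : absIntegers (𝓞 ℚ) ℚ, x ∈ 𝔓 ↔ (x : AlgebraicClosure ℚ) ∈ (placeOver 3).nonunits)
    (h𝔓 : 𝔓 ∈ v.primesAbove) :
    ∃ s ∈ 𝔓.inertia (absoluteGaloisGroup ℚ), (∀ P ∈ geomTorsion W 3, s • P = P) ∧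
      ¬ ∃ m : ℕ, ∀ Q ∈ geomTorsion W 9, s • Q = (1 + 3 * m) • Q := by
  haveI : Fact (Nat.Prime 3) := ⟨Nat.prime_three⟩
  haveI : 𝔓.IsPrime := h𝔓.1
  set I := 𝔓.inertia (absoluteGaloisGroup ℚ) with hI
  set K₉ := (galoisRepTorsion W 9).ker with hK₉
  set K₃ := (galoisRepTorsion W 3).ker with hK₃
  -- `ker ρ̄₉ ≤ ker ρ̄₃`
  have hK : K₉ ≤ K₃ := by
    intro σ hσ
    rw [hK₉, MonoidHom.mem_ker, galoisRepTorsion_eq_one_iff'] at hσ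
    rw [hK₃, MonoidHom.mem_ker, galoisRepTorsion_eq_one_iff']
    intro P
    have hP9 : (P : W.geomPoints) ∈ geomTorsion W 9 := by
      have h3 := (Submodule.mem_torsionBy_iff _ _).mp P.2
      refine (Submodule.mem_torsionBy_iff _ _).mpr ?_
      rw [show (9 : ℤ) = 3 * 3 by norm_num, mul_smul, h3, smul_zero]
    have h : σ • (P : W.geomPoints) = P := congrArg Subtype.val (hσ ⟨P, hP9⟩)
    exact Subtype.ext h
  -- `#ρ̄₃(I) = 8`
  have hm : 0 < 3 ^ 2 - 1 := by norm_num
  have hB : K₃.relIndex I = 8 := by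
    rw [hK₃, Subgroup.relIndex_ker]
    have h : Nat.card (I.map (galoisRepTorsion W 3)) = 3 ^ 2 - 1 :=
      (isCyclic_and_card_inertia_map_of_dvd_frobeniusTrace 3 hΔ hss (by norm_num) hmem
        (fun π ζ hπ hζ ↦ exists_mem_inertia_smul_eq_mul_of_pow_eq 3 hm hv h𝔓 hπ hζ)).2
    rw [show (3 : ℕ) ^ 2 - 1 = 8 by norm_num] at h
    exact h
  -- `36 ∣ #ρ̄₉(I)` and `#ρ̄₉(I) = #ρ̄₉(K₃ ⊓ I) · 8`
  have hA := dvd_card_inertia_map_galoisRepTorsion_nine hΔ hss hv hmem h𝔓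
  have hApos := card_inertia_map_galoisRepTorsion_nine_pos (W := W) (𝔓 := 𝔓)
  rw [← hI, ← Subgroup.relIndex_ker, ← hK₉] at hA hApos
  have hmul : K₉.relIndex (K₃ ⊓ I) * 8 = K₉.relIndex I := by
    rw [← hB, Subgroup.relIndex_inf_mul_relIndex, inf_eq_left.mpr hK]
  have hC9 : 9 ∣ K₉.relIndex (K₃ ⊓ I) := by omega
  have hCpos : 0 < K₉.relIndex (K₃ ⊓ I) := by
    by_contra h0
    have : K₉.relIndex (K₃ ⊓ I) = 0 := by omega
    rw [this, zero_mul] at hmul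
    omega
  -- if every element of `I ∩ ker ρ̄₃` were a scalar, `#ρ̄₉(K₃ ⊓ I) ≤ 3`
  by_contra hall
  push Not at hall
  rw [hK₉, Subgroup.relIndex_ker] at hC9 hCpos
  set C := (K₃ ⊓ I).map (galoisRepTorsion W 9) with hC
  -- choose for each element of the image a preimage and its scalar
  have hsc : ∀ φ : C, ∃ m : ℕ, ∀ Q : geomTorsion W 9,
      ((φ : Multiplicative (AddAut (geomTorsion W 9))).toAdd Q : W.geomPoints) = (1 + 3 * m) • (Q : W.geomPoints) := by
    intro φ
    obtain ⟨sφ, hsφ, hφ⟩ := Subgroup.mem_map.mp φ.2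
    have hsI : sφ ∈ 𝔓.inertia (absoluteGaloisGroup ℚ) := hsφ.2
    have hs3 : ∀ P ∈ geomTorsion W 3, sφ • P = P := by
      intro P hP
      have := (galoisRepTorsion_eq_one_iff' W 3 sφ).mp hsφ.1 ⟨P, hP⟩
      exact congrArg Subtype.val this
    obtain ⟨m, hm⟩ := hall sφ hsI hs3
    refine ⟨m, fun Q ↦ ?_⟩
    rw [← hφ, galoisRepTorsion_apply, AddSubgroup.torsionBy.coe_smul]
    exact hm Q Q.2
  choose mφ hmφ using hsc
  have hinj : Function.Injective fun φ : C ↦ (mφ φ : ZMod 3) := by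
    intro φ ψ hφψ
    have hmod : mφ φ % 3 = mφ ψ % 3 := (ZMod.natCast_eq_natCast_iff' _ _ 3).mp hφψ
    apply Subtype.ext
    refine Multiplicative.toAdd.injective (AddEquiv.ext fun Q ↦ Subtype.ext ?_)
    have hQ9 : (Q : W.geomPoints) ∈ AddSubgroup.torsionBy W.geomPoints ((9 : ℕ) : ℤ) := by
      exact_mod_cast Q.2
    have key : ∀ m : ℕ, (1 + 3 * m) • (Q : W.geomPoints) = ((1 + 3 * m) % 9) • (Q : W.geomPoints) :=
      fun m ↦ AddSubgroup.torsionBy.mod_self_nsmul' _ hQ9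
    rw [hmφ φ Q, hmφ ψ Q, key, key (mφ ψ)]
    congr 1
    omega
  have hle : Nat.card C ≤ Nat.card (ZMod 3) := Nat.card_le_card_of_injective _ hinj
  rw [Nat.card_zmod] at hle
  omega

/-- **Some element of `I_𝔓` fixing `E[3]` moves `ζ₉`**: `χ₃(I_𝔓) = ℤ₃ˣ`
(`exists_mem_inertia_cyclotomicCharacter_eq`) gives `τ₀ ∈ I_𝔓` with `χ₃(τ₀) = 4`; its eighth power
fixes `E[3]` (`#ρ̄_{E,3}(I_𝔓) = 8`, Serre 1972 §1.11 Prop. 12 c)) and has `χ₃ ≡ 4⁸ ≡ 7 (mod 9)`.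
[cite: Serre1972, §1.11 Prop. 12 c)] [cite: NeukirchANT1999, Ch. II (7.13)(i)] -/
theorem exists_mem_inertia_fixing_three_smul_ne
    (hΔ : ¬ (3 : ℤ) ∣ minimalDiscriminantInt W) (hss : (3 : ℤ) ∣ W.frobeniusTrace 3)
    {v : HeightOneSpectrum (𝓞 ℚ)} (hv : (primesEquiv v : ℕ) = 3)
    {𝔓 : Ideal (absIntegers (𝓞 ℚ) ℚ)}
    (hmem : ∀ x : absIntegers (𝓞 ℚ) ℚ, x ∈ 𝔓 ↔ (x : AlgebraicClosure ℚ) ∈ (placeOver 3).nonunits)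
    (h𝔓 : 𝔓 ∈ v.primesAbove) {ζ : AlgebraicClosure ℚ} (hζ : IsPrimitiveRoot ζ 9) :
    ∃ s ∈ 𝔓.inertia (absoluteGaloisGroup ℚ), (∀ P ∈ geomTorsion W 3, s • P = P) ∧ s • ζ = ζ ^ 7 := by
  haveI : Fact (Nat.Prime 3) := ⟨Nat.prime_three⟩
  haveI : 𝔓.IsPrime := h𝔓.1
  haveI : NeZero ((3 : ℕ) : ℚ) := ⟨by norm_num⟩
  set I := 𝔓.inertia (absoluteGaloisGroup ℚ) with hI
  -- a unit `u = 1 + 3` of `ℤ₃`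
  have hunit : IsUnit ((1 : ℤ_[3]) + (3 : ℕ)) := by
    have hmem3 : -((3 : ℕ) : ℤ_[3]) ∈ nonunits ℤ_[3] := by
      rw [← IsLocalRing.mem_maximalIdeal, PadicInt.maximalIdeal_eq_span_p]
      exact Submodule.neg_mem _ (Ideal.mem_span_singleton_self _)
    have h := IsLocalRing.isUnit_one_sub_self_of_mem_nonunits _ hmem3
    rwa [sub_neg_eq_add] at h
  obtain ⟨τ₀, hτ₀I, hχ⟩ := exists_mem_inertia_cyclotomicCharacter_eq (p := 3) hv h𝔓 hunit.unit
  -- `τ₀⁸` fixes `E[3]`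
  have hm : 0 < 3 ^ 2 - 1 := by norm_num
  have hcard : Nat.card (I.map (galoisRepTorsion W 3)) = 3 ^ 2 - 1 :=
    (isCyclic_and_card_inertia_map_of_dvd_frobeniusTrace 3 hΔ hss (by norm_num) hmem
      (fun π ζ hπ hζ ↦ exists_mem_inertia_smul_eq_mul_of_pow_eq 3 hm hv h𝔓 hπ hζ)).2
  rw [show (3 : ℕ) ^ 2 - 1 = 8 by norm_num] at hcard
  have hmemρ : galoisRepTorsion W 3 τ₀ ∈ I.map (galoisRepTorsion W 3) := Subgroup.mem_map_of_mem _ hτ₀I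
  have hpow : galoisRepTorsion W 3 (τ₀ ^ 8) = 1 := by
    have h := pow_card_eq_one' (x := (⟨galoisRepTorsion W 3 τ₀, hmemρ⟩ : I.map (galoisRepTorsion W 3)))
    rw [hcard] at h
    have h' := congrArg Subtype.val h
    rw [Subgroup.coe_pow, Subgroup.coe_one] at h'
    rw [map_pow]
    exact h'
  refine ⟨τ₀ ^ 8, I.pow_mem hτ₀I 8, ?_, ?_⟩
  · intro P hP
    exact congrArg Subtype.val ((galoisRepTorsion_eq_one_iff' W 3 (τ₀ ^ 8)).mp hpow ⟨P, hP⟩)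
  · -- `χ₃(τ₀⁸) = (1+3)⁸ ≡ 7 (mod 9)`
    have hspec := GaloisRep.cyclotomicCharacter_spec ℚ 3 (k := 2) (τ₀ ^ 8) ζ
      (by rw [show (3 : ℕ) ^ 2 = 9 by norm_num]; exact hζ.pow_eq_one)
    rw [hspec, map_pow, hχ, Units.val_pow_eq_pow_val, IsUnit.unit_spec, map_pow, map_add, map_one,
      map_natCast]
    have h7 : ((1 + (3 : ℕ) : ZMod (3 ^ 2)) ^ 8).val = 7 := by decide
    rw [h7]

/-- **The torsion-level witness at a good supersingular `3`**: some `τ ∈ Γ_ℚ` fixes `E[3]`, is not a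
scalar `(1 + 3m)·` on `E[9]`, and moves a ninth root of unity (one of `s₁`, `s₂`, `s₁ s₂` for the
two elements above; a group is not the union of two proper subgroups).
[cite: Serre1972, §1.11 Prop. 12 c)] [cite: SerreLocalFields1979, Ch. I §7 Cor. to Prop. 21 and Prop. 22(b)] -/
theorem exists_torsionWitness_of_goodSupersingular_three
    (hΔ : ¬ (3 : ℤ) ∣ minimalDiscriminantInt W) (hss : (3 : ℤ) ∣ W.frobeniusTrace 3) :
    ∃ τ : absoluteGaloisGroup ℚ, (∀ P ∈ geomTorsion W 3, τ • P = P) ∧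
      (¬ ∃ m : ℕ, ∀ Q ∈ geomTorsion W 9, τ • Q = (1 + 3 * m) • Q) ∧
      ∃ t : AlgebraicClosure ℚ, t ^ 9 = 1 ∧ τ • t ≠ t := by
  haveI : Fact (Nat.Prime 3) := ⟨Nat.prime_three⟩
  obtain ⟨v, hv⟩ : ∃ v : HeightOneSpectrum (𝓞 ℚ), (primesEquiv v : ℕ) = 3 :=
    ⟨primesEquiv.symm ⟨3, Nat.prime_three⟩, by rw [Equiv.apply_symm_apply]⟩
  obtain ⟨𝔓, hmem, h𝔓⟩ := exists_ideal_placeOver 3 hv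
  obtain ⟨ζ, hζ⟩ := HasEnoughRootsOfUnity.exists_primitiveRoot (AlgebraicClosure ℚ) 9
  have hζ9 : ζ ^ 9 = 1 := hζ.pow_eq_one
  have hζ7 : ζ ^ 7 ≠ ζ := by
    intro h
    have h6 : ζ ^ 6 = 1 := by
      have hζ0 : ζ ≠ 0 := hζ.ne_zero (by norm_num)
      have : ζ ^ 6 * ζ = 1 * ζ := by rw [← pow_succ, h, one_mul]
      exact mul_right_cancel₀ hζ0 this
    have := (hζ.pow_eq_one_iff_dvd 6).mp h6
    omega
  obtain ⟨s₁, -, hs₁3, hs₁⟩ := exists_mem_inertia_fixing_three_not_scalar_nine hΔ hss hv hmem h𝔓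
  obtain ⟨s₂, -, hs₂3, hs₂⟩ := exists_mem_inertia_fixing_three_smul_ne hΔ hss hv hmem h𝔓 hζ
  by_cases hmove : ∃ t : AlgebraicClosure ℚ, t ^ 9 = 1 ∧ s₁ • t ≠ t
  · exact ⟨s₁, hs₁3, hs₁, hmove⟩
  push Not at hmove
  by_cases hsc₂ : ∃ m : ℕ, ∀ Q ∈ geomTorsion W 9, s₂ • Q = (1 + 3 * m) • Q
  · refine ⟨s₁ * s₂, fun P hP ↦ by rw [mul_smul, hs₂3 P hP, hs₁3 P hP],
      fun hsc ↦ hs₁ (scalar_of_scalar_mul_of_scalar hsc hsc₂), ζ, hζ9, ?_⟩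
    rw [mul_smul, hs₂, smul_pow', hmove ζ hζ9]
    exact hζ7
  · exact ⟨s₂, hs₂3, hsc₂, ζ, hζ9, by rw [hs₂]; exact hζ7⟩

end Witness

/-! ### §4 The tower at a good supersingular `3`, and Lemma 20 as printed -/

section Tower

/-- **Wuthrich 2014, Lemma 20 — good supersingular case, PROVED.**  For an elliptic curve `E/ℚ`
given by a globally minimal `W` with good SUPERSINGULAR reduction at `3` (`3 ∤ N`, `3 ∣ a₃`):
if `ρ̄_{E,3} : Γ_ℚ → GL₂(𝔽₃)` is onto then `ρ̄_{E,3ⁿ}` is onto for every `n` (Kato's (12.5.2) at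
`p = 3`).  Local proof: the inertia group at `3` acts on `E[9]` through a group of order divisible
by `72`, which no exotic `3`-adic image allows (`exists_torsionWitness_of_goodSupersingular_three` +
`forall_hasSurjectiveModNGaloisRep_three_pow_of_torsionWitness`).
[cite: Wuthrich2014, Lemma 20 (p. 399)] [cite: Serre1972, §1.11 Prop. 12]
[cite: SerreAbelianLadic1968, Ch. IV §3.4, Lemma 3 (IV-23)] -/
theorem _root_.WeierstrassCurve.forall_hasSurjectiveModNGaloisRep_three_pow_of_goodSupersingular_of_surj
    (W : WeierstrassCurve ℚ) [W.IsElliptic] [W.IsGloballyMinimal]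
    (hgood : W.HasGoodReductionAtPrime 3) (hss : (3 : ℤ) ∣ W.frobeniusTrace 3)
    (hsurj : W.HasSurjectiveModNGaloisRep 3) (n : ℕ) : W.HasSurjectiveModNGaloisRep (3 ^ n : ℕ) := by
  haveI : Fact (Nat.Prime 3) := ⟨Nat.prime_three⟩
  have hΔ := W.not_dvd_minimalDiscriminantInt_of_hasGoodReductionAtPrime' 3 hgood
  obtain ⟨τ, h1, hns, hζ⟩ := exists_torsionWitness_of_goodSupersingular_three (W := W) hΔ hss
  exact W.forall_hasSurjectiveModNGaloisRep_three_pow_of_torsionWitness hsurj τ h1 hns hζ n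

/-- **Wuthrich 2014, Lemma 20 at every prime-to-`9` conductor, PROVED (globally minimal model):**
for `E/ℚ` minimal with good OR multiplicative reduction at `3`, `ρ̄_{E,3}` onto ⟹ every `ρ̄_{E,3ⁿ}`
onto.  The good ordinary and multiplicative cases are lit-kato's
`forall_hasSurjectiveModNGaloisRep_three_pow_of_not_additive_of_not_supersingular`
(`Wuthrich2014/ThreeAdicImageOrdinaryProofs`); the good supersingular case is the theorem above.
[cite: Wuthrich2014, Lemma 20 (p. 399)] -/
theorem _root_.WeierstrassCurve.forall_hasSurjectiveModNGaloisRep_three_pow_of_not_additive_of_surj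
    (W : WeierstrassCurve ℚ) [W.IsElliptic] [W.IsGloballyMinimal]
    (hred : W.HasGoodReductionAtPrime 3 ∨ W.HasMultiplicativeReductionAtPrime 3)
    (hsurj : W.HasSurjectiveModNGaloisRep 3) (n : ℕ) : W.HasSurjectiveModNGaloisRep (3 ^ n : ℕ) := by
  haveI : Fact (Nat.Prime 3) := ⟨Nat.prime_three⟩
  rcases hred with hgood | hmult
  · by_cases hss : (3 : ℤ) ∣ W.frobeniusTrace 3
    · exact W.forall_hasSurjectiveModNGaloisRep_three_pow_of_goodSupersingular_of_surj hgood hss hsurj n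
    · exact W.forall_hasSurjectiveModNGaloisRep_three_pow_of_not_additive_of_not_supersingular
        (Or.inl ⟨hgood, hss⟩) hsurj n
  · exact W.forall_hasSurjectiveModNGaloisRep_three_pow_of_not_additive_of_not_supersingular
      (Or.inr hmult) hsurj n

/-- **Wuthrich 2014, Lemma 20, AS PRINTED — the named fact
`Wuthrich2014.lemma20_surjective_threeAdic_of_semistable` DISCHARGED.**  For every elliptic curve
`E/ℚ` (any Weierstrass model) with good or multiplicative reduction at `3` ("`3² ∤ N`"): if
`ρ̄_{E,3}` is onto `GL₂(𝔽₃)` then `ρ̄_{E,3ⁿ}` is onto for every `n` ("`ρ : Gal(ℚ̄/ℚ) → GL₂(ℤ₃)`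
is surjective, too").  Reduction to a globally minimal model (`hasGlobalMinimalModel_rat_holds`;
the reduction types and the surjectivity of `ρ̄_{E,m}` are isomorphism invariants:
`hasGoodReductionAtPrime_iff_of_variableChange`, `hasMultiplicativeReductionAtPrime_smul_iff`,
`hasSurjectiveModNGaloisRep_smul_iff`) and
`forall_hasSurjectiveModNGaloisRep_three_pow_of_not_additive_of_surj`.  The proof is NOT
Wuthrich's (Elkies' modular curve of level `9`) but local at `3`: inertia words in the ordinary and
multiplicative cases (unit `b2b-bsdres-lit-kato`), wild ramification of the `9`-torsion of the
height-`2` formal group in the supersingular case (this file). [cite: Wuthrich2014, Lemma 20 (p. 399)] -/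
theorem Wuthrich2014.lemma20_surjective_threeAdic_of_semistable_holds :
    Wuthrich2014.lemma20_surjective_threeAdic_of_semistable := by
  intro W _ hred hsurj n
  haveI : Fact (Nat.Prime 3) := ⟨Nat.prime_three⟩
  obtain ⟨C, hC⟩ := hasGlobalMinimalModel_rat_holds W
  haveI : (C • W).IsGloballyMinimal := hC
  have hred' : (C • W).HasGoodReductionAtPrime 3 ∨ (C • W).HasMultiplicativeReductionAtPrime 3 := by
    rcases hred with h | h
    · exact Or.inl ((W.hasGoodReductionAtPrime_iff_of_variableChange C 3).mpr h)
    · exact Or.inr ((hasMultiplicativeReductionAtPrime_smul_iff W C 3).mpr h)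
  have hsurj' : (C • W).HasSurjectiveModNGaloisRep 3 :=
    (hasSurjectiveModNGaloisRep_smul_iff W C 3).mpr hsurj
  exact (hasSurjectiveModNGaloisRep_smul_iff W C (3 ^ n : ℕ)).mp
    ((C • W).forall_hasSurjectiveModNGaloisRep_three_pow_of_not_additive_of_surj hred' hsurj' n)

/-- **Kato's (12.5.2) at a good supersingular `3` from the census bit surj(3)**: for `E/ℚ` minimal
with good supersingular reduction at `3` and `ρ̄_{E,3}` onto, the image of `Gal(ℚ̄/ℚ(ζ_{3^∞}))`
in `GL_{ℤ₃}(T₃E)` contains `SL₂(ℤ₃)` (`Kato2004.imageContainsSL2_iff_forall_hasSurjectiveModNGaloisRep`).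
[cite: Kato2004Asterisque, (12.5.2) in Thm. 12.5 (4) (p. 222)] [cite: Wuthrich2014, Lemma 20 (p. 399)] -/
theorem Kato2004.imageContainsSL2_of_goodSupersingular_three_of_surj (W : WeierstrassCurve ℚ)
    [W.IsElliptic] [W.IsGloballyMinimal]
    (hgood : W.HasGoodReductionAtPrime 3) (hss : (3 : ℤ) ∣ W.frobeniusTrace 3)
    (hsurj : W.HasSurjectiveModNGaloisRep 3) :
    haveI : Fact (Nat.Prime 3) := ⟨Nat.prime_three⟩
    Kato2004.ImageContainsSL2 W 3 := by
  haveI : Fact (Nat.Prime 3) := ⟨Nat.prime_three⟩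
  exact Kato2004.imageContainsSL2_of_forall_hasSurjectiveModNGaloisRep W 3
    (W.forall_hasSurjectiveModNGaloisRep_three_pow_of_goodSupersingular_of_surj hgood hss hsurj)

end Tower

end Literature.NumberTheory.EllipticCurves

end
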